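import Summits.ResolutionOfSingularities.ResolutionOfSingularities.Theorems.FrobeniusLadderFInjectiveMacaulayficationProp44SliceCurve
import Summits.ResolutionOfSingularities.ResolutionOfSingularities.Theorems.FrobeniusLadderFInjectiveMacaulayficationProp44CurveStepCurves
import Summits.ResolutionOfSingularities.ResolutionOfSingularities.Theorems.FrobeniusLadderFInjectiveMacaulayficationProp44SliceCurveLocal
import Literature.AlgebraicGeometry.Resolution.CurveCentreNearPointGammaPrimeRegular
import HarnessLib

/-!
# [CoP1] Prop. 4.4 (`CossartPiltant2008_prop44`, F-71): the curve slice from the `τ = 1` point slice ALONE, and the curve-step bookkeeping (ρ2)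
# UNCONDITIONALLY — Lemma 4.3 (4) `Γ′` (T2b′) is now a tree theorem

[L1 W4.5a · crux `FInjectiveMacaulayfication` (stmt-ResolutionOfSingularities-15315); D-0154 (2) RES inputs cell, seat res-inputs-p-8b (gen 2, «assembly»).
PROVED, fact-free, definition-free; nothing of the manuscript under adjudication is used. AI-written; AI review is weaker than expert review.]

`…Prop44SliceCurve.lean` (p620059) and `…Prop44CurveStepCurves.lean` (p621516) took [CoP1] Lemma 4.3 (4) «`Γ′` is either empty or a regular irreducible curve
projecting isomorphically to `Y`» as an ORACLE hypothesis `hT2b'` (binders of the cell's stub `stub_T2b'_isRegular_gammaPrime`). That statement is now the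
tree theorem `IsBlowup.isRegular_gammaPrime_of_isNear_curve` (res-inputs-p-6, `CurveCentreNearPointGammaPrimeRegular.lean`, p622153; binders and conclusion
verbatim), so the oracle is discharged by `exact`:

* `orderReducible_comap_of_curve_of_pointSlice'`, `stub_curve_of_pointSlice'` — the regular-curve slice from the isolated `τ = 1` point slice `hpt` ALONE;
* `curveStep_curves'` — ρ2 (res-inputs-p-5a's frozen residual oracle, REACH decomposition a2aaba0190a2cf04 :160) with NO oracle: binders = the frozen text
  verbatim (`hcodim` unused, underscored);
* `orderReducible_comap_of_curve_aux_rich`, `orderReducible_comap_of_curve_of_pointSliceRich`, `stub_curve_of_pointSliceRich` — the same slice from the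
  point-slice oracle taken in the RICH form res-inputs-p-8a's descent theorem delivers (`orderReducible_comap_of_isolated_tau_one_of_descent`: the point
  slice WITH the riders `[IsIntegral X] [IsNoetherian X] (hqe) (hX3)`), via the LOCAL step of p621180, which hands exactly these invariants of the blown-up
  stage to its point oracle.

`CossartPiltant2008_prop44` is NOT proved (the `τ = 1` point slice and REACH remain); resolution in dimension `≥ 4` / positive characteristic is NOT proved.

References: V. Cossart, O. Piltant, J. Algebra 320 (2008), Lemma 4.3 (2) (4), Prop. 4.4 (proof, p. 10) [CossartPiltant2008].
-/

-- `Summit.<Summit>.<Sub>.Theorems` with `Sub = Summit` (single-conjunct summit, D-0017)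
set_option linter.dupNamespace false

noncomputable section

open CategoryTheory CategoryTheory.Limits AlgebraicGeometry TopologicalSpace IsLocalRing
open Literature.AlgebraicGeometry.Resolution Scheme.IdealSheafData

namespace Summit.ResolutionOfSingularities.ResolutionOfSingularities.Theorems

namespace CP2008Prop44

universe u

/-- **The regular-curve slice of [CoP1] Prop. 4.4 relative to an open, from the isolated `τ = 1` point slice ALONE** (= `orderReducible_comap_of_curve_of_pointSlice`
with its second oracle discharged by the tree's Lemma 4.3 (4), p622153). [cite: CossartPiltant2008, Prop. 4.4 (proof, p. 10), Lemma 4.3 (2) (4)] -/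
theorem orderReducible_comap_of_curve_of_pointSlice' {X : Scheme.{u}} [IsIntegral X] [IsNoetherian X]
    (hX : Scheme.IsRegular X) (hqe : Scheme.IsQuasiExcellent X) (hX3 : topologicalKrullDim X ≤ 3)
    (J : X.IdealSheafData) {m : ℕ} (hm : 1 ≤ m) (hle : ∀ z, idealOrder J z ≤ m)
    (hcodim : ∀ z ∈ J.support, 1 < Order.coheight z) (V : X.Opens) (Y : Closeds X)
    (hreg : Scheme.IsRegular (vanishingIdeal Y).subscheme) (hirr : IsIrreducible (Y : Set X))
    (hYV : (Y : Set X) ⊆ (V : Set X))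
    (hJY : ∀ z : X, (m : ℕ∞) ≤ idealOrder J z → z ∈ (Y : Set X) ∨ z ∉ (V : Set X))
    (hord : ∀ y ∈ (Y : Set X), idealOrder J y = m)
    (hcurve : ∀ y ∈ (Y : Set X), haveI := hX y; ∃ c : Fin 2 → X.presheaf.stalk y, IsRsopPart c ∧
      Ideal.span (Set.range c) = stalkIdeal (vanishingIdeal Y) y)
    (hpt : ∀ ⦃X : Scheme.{u}⦄ [IsLocallyNoetherian X] (hX : Scheme.IsRegular X) (J : X.IdealSheafData) ⦃m : ℕ⦄ (_hm : 1 ≤ m)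
      (_hle : ∀ z, idealOrder J z ≤ m) (_hcodim : ∀ z ∈ J.support, 1 < Order.coheight z) (V : X.Opens) (x : X) (_hxV : x ∈ V)
      (_hcl : IsClosed ({x} : Set X)) (_hbad : ∀ z : X, (m : ℕ∞) ≤ idealOrder J z → z = x ∨ z ∉ (V : Set X))
      (_hord : idealOrder J x = m) (_hdim : (maximalIdeal (X.presheaf.stalk x)).spanFinrank = 3)
      (_hτ : haveI := hX x; stalkTau J x m = 1) (_hG : IsGRing (X.presheaf.stalk x)),
      CampaignW46.OrderReducible (J.comap V.ι) m) :
    CampaignW46.OrderReducible (J.comap V.ι) m :=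
  orderReducible_comap_of_curve_of_pointSlice hX hqe hX3 J hm hle hcodim V Y hreg hirr hYV hJY hord hcurve hpt
    fun _ _ _ _ hX _ _ hYirr hreg hπ _ _ hμ hY hJ _ hη' hcodim hnear =>
      hπ.isRegular_gammaPrime_of_isNear_curve hX hYirr hreg hμ hY hJ hη' hcodim hnear

/-- **The patching skeleton's `stub_curve` from `stub_tauOne_point` ALONE** (binders of `stub_curve`, skeleton v3.1, VERBATIM — with the riders `[IsNoetherian X]`,
`hX3` — followed by the single oracle `hpt` = `stub_tauOne_point` + `hcodim`). [cite: CossartPiltant2008, Prop. 4.4 (proof, p. 10), Lemma 4.3 (2) (4), Lemma 4.5 (1)] -/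
theorem stub_curve_of_pointSlice' {X : Scheme.{u}} [IsIntegral X] [IsNoetherian X] (hX : Scheme.IsRegular X)
    (hqe : Scheme.IsQuasiExcellent X) (hX3 : topologicalKrullDim X ≤ 3) (J : X.IdealSheafData) {m : ℕ} (hm : 1 ≤ m)
    (hle : ∀ z, idealOrder J z ≤ m)
    (hcodim : ∀ z ∈ J.support, 1 < Order.coheight z) (V : X.Opens) (Y : Closeds X)
    (hreg : Scheme.IsRegular (vanishingIdeal Y).subscheme) (hirr : IsIrreducible (Y : Set X)) (hYV : (Y : Set X) ⊆ (V : Set X))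
    (hJY : ∀ z : X, (m : ℕ∞) ≤ idealOrder J z → z ∈ (Y : Set X) ∨ z ∉ (V : Set X))
    (hord : ∀ y ∈ (Y : Set X), idealOrder J y = m)
    (hcurve : ∀ y ∈ (Y : Set X), haveI := hX y; ∃ c : Fin 2 → X.presheaf.stalk y, IsRsopPart c ∧
      Ideal.span (Set.range c) = stalkIdeal (vanishingIdeal Y) y)
    (_hτ1 : ¬ ∀ y ∈ (Y : Set X), haveI := hX y; 2 ≤ stalkTau J y m)
    (hpt : ∀ ⦃X : Scheme.{u}⦄ [IsLocallyNoetherian X] (hX : Scheme.IsRegular X) (J : X.IdealSheafData) ⦃m : ℕ⦄ (_hm : 1 ≤ m)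
      (_hle : ∀ z, idealOrder J z ≤ m) (_hcodim : ∀ z ∈ J.support, 1 < Order.coheight z) (V : X.Opens) (x : X) (_hxV : x ∈ V)
      (_hcl : IsClosed ({x} : Set X)) (_hbad : ∀ z : X, (m : ℕ∞) ≤ idealOrder J z → z = x ∨ z ∉ (V : Set X))
      (_hord : idealOrder J x = m) (_hdim : (maximalIdeal (X.presheaf.stalk x)).spanFinrank = 3)
      (_hτ : haveI := hX x; stalkTau J x m = 1) (_hG : IsGRing (X.presheaf.stalk x)),
      CampaignW46.OrderReducible (J.comap V.ι) m) :
    CampaignW46.OrderReducible (J.comap V.ι) m :=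
  orderReducible_comap_of_curve_of_pointSlice' hX hqe hX3 J hm hle hcodim V Y hreg hirr hYV hJY hord hcurve hpt

/-- **ρ2 — CURVE-STEP BOOKKEEPING, UNCONDITIONAL** ([CoP1] Lemma 4.3 (2), (4); Prop. 4.4 p. 10 «n(i+1) ≤ n(i)»): binders of the frozen signature `curveStep_curves`
(res-inputs-p-5a, a2aaba0190a2cf04 :160) VERBATIM (`hcodim` unused, underscored), NO oracle. After blowing up a regular order-`μ` curve `Y`, a non-closed maximal
point of `Σ′` is the generic point of the strict transform of a curve of `Σ` off `Y`, or THE curve `Γ′` over `Y`, regular with rsop pairs.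
[cite: CossartPiltant2008, Lemma 4.3 (2) (4); Prop. 4.4 (proof, p. 10)] -/
theorem curveStep_curves' {X X' : Scheme.{u}} [IsLocallyNoetherian X] [IsLocallyNoetherian X'] (hX : Scheme.IsRegular X)
    (hX3 : topologicalKrullDim X ≤ 3) (J : X.IdealSheafData) {μ : ℕ} (hμ : 1 ≤ μ) (hle : ∀ z, idealOrder J z ≤ μ)
    (_hcodim : ∀ z ∈ J.support, 1 < Order.coheight z) {Y : Closeds X}
    (hYreg : Scheme.IsRegular (vanishingIdeal Y).subscheme) (hYirr : IsIrreducible (Y : Set X))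
    (hYord : ∀ y ∈ (Y : Set X), idealOrder J y = μ)
    (hYcurve : ∀ y ∈ (Y : Set X), ∀ hr : IsRegularLocalRing (X.presheaf.stalk y),
      ∃ c : Fin 2 → X.presheaf.stalk y, @IsRsopPart _ _ _ 2 c ∧ Ideal.span (Set.range c) = stalkIdeal (vanishingIdeal Y) y)
    {π : X' ⟶ X} (hπ : IsBlowup π (vanishingIdeal Y)) {η' : X'}
    (hη' : η' ∈ maxPoints {z : X' | (μ : ℕ∞) ≤ idealOrder (controlledTransform π (vanishingIdeal Y) J μ) z})
    (hη'cl : ¬ IsClosed ({η'} : Set X')) :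
    (π η' ∉ (Y : Set X) ∧ π η' ∈ maxPoints {z : X | (μ : ℕ∞) ≤ idealOrder J z} ∧
        closure ({η'} : Set X') = closure (π ⁻¹' (closure {π η'} \ (Y : Set X)))) ∨
      (closure ({π η'} : Set X) = (Y : Set X) ∧
        Scheme.IsRegular (vanishingIdeal (⟨closure {η'}, isClosed_closure⟩ : Closeds X')).subscheme ∧
        (∀ y ∈ closure ({η'} : Set X'), ∀ hr : IsRegularLocalRing (X'.presheaf.stalk y),
          ∃ c : Fin 2 → X'.presheaf.stalk y, @IsRsopPart _ _ _ 2 c ∧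
            Ideal.span (Set.range c) = stalkIdeal (vanishingIdeal (⟨closure {η'}, isClosed_closure⟩ : Closeds X')) y) ∧
        ∀ η'' ∈ maxPoints {z : X' | (μ : ℕ∞) ≤ idealOrder (controlledTransform π (vanishingIdeal Y) J μ) z},
          ¬ IsClosed ({η''} : Set X') → π η'' ∈ (Y : Set X) → η'' = η') :=
  curveStep_curves hX hX3 J hμ hle _hcodim hYreg hYirr hYord hYcurve hπ hη' hη'cl
    fun _ _ _ _ hX _ _ hYirr hreg hπ _ _ hμ hY hJ _ hη' hcodim hnear =>
      hπ.isRegular_gammaPrime_of_isNear_curve hX hYirr hreg hμ hY hJ hη' hcodim hnear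


/-! ## The slice from the RICH point-slice oracle (the shape res-inputs-p-8a's descent theorem delivers) -/

/-- **Induction on the colength, RICH oracle**: as `orderReducible_comap_of_curve_aux` (p620059) but with the point-slice oracle asked only on INTEGRAL NOETHERIAN
quasi-excellent stages of dimension `≤ 3` (the riders of res-inputs-p-8a's `orderReducible_comap_of_isolated_tau_one_of_descent`), through the LOCAL step
`orderReducible_comap_of_curve_step_local` (p621180) and Lemma 4.3 (4) (p622153). [cite: CossartPiltant2008, Prop. 4.4 (proof, p. 10), Lemma 4.3 (2) (4)] -/
theorem orderReducible_comap_of_curve_aux_rich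
    (hpt : ∀ ⦃X : Scheme.{u}⦄ [IsIntegral X] [IsNoetherian X] (hX : Scheme.IsRegular X) (_hqe : Scheme.IsQuasiExcellent X)
      (_hX3 : topologicalKrullDim X ≤ 3) (J : X.IdealSheafData) ⦃m : ℕ⦄ (_hm : 1 ≤ m)
      (_hle : ∀ z, idealOrder J z ≤ m) (_hcodim : ∀ z ∈ J.support, 1 < Order.coheight z) (V : X.Opens) (x : X) (_hxV : x ∈ V)
      (_hcl : IsClosed ({x} : Set X)) (_hbad : ∀ z : X, (m : ℕ∞) ≤ idealOrder J z → z = x ∨ z ∉ (V : Set X))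
      (_hord : idealOrder J x = m) (_hdim : (maximalIdeal (X.presheaf.stalk x)).spanFinrank = 3)
      (_hτ : haveI := hX x; stalkTau J x m = 1) (_hG : IsGRing (X.presheaf.stalk x)),
      CampaignW46.OrderReducible (J.comap V.ι) m)
    {m : ℕ} (hm : 1 ≤ m) (N : ℕ) :
    ∀ ⦃X : Scheme.{u}⦄ [IsIntegral X] [IsNoetherian X], Scheme.IsRegular X → Scheme.IsQuasiExcellent X →
      topologicalKrullDim X ≤ 3 → ∀ (J : X.IdealSheafData), (∀ z, idealOrder J z ≤ m) →
      (∀ z ∈ J.support, 1 < Order.coheight z) → ∀ (V : X.Opens) (Y : Closeds X) (η : X),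
      (Y : Set X) = closure {η} → Order.coheight η = 2 → Scheme.IsRegular (vanishingIdeal Y).subscheme →
      (Y : Set X) ⊆ (V : Set X) → (∀ z : X, (m : ℕ∞) ≤ idealOrder J z → z ∈ (Y : Set X) ∨ z ∉ (V : Set X)) →
      (∀ y ∈ (Y : Set X), idealOrder J y = m) →
      Module.length (X.presheaf.stalk η) (X.presheaf.stalk η ⧸ stalkIdeal J η) ≤ N →
      CampaignW46.OrderReducible (J.comap V.ι) m := by
  induction N with
  | zero =>
    intro X _ _ hX hqe hX3 J hle hcodim V Y η hYη hcoh hreg hYV hJY hord hlen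
    obtain ⟨X', π, hπ⟩ := exists_isBlowup X (vanishingIdeal Y)
    refine orderReducible_comap_of_curve_step_local hm hX hqe hX3 J hle hcodim V Y η hYη hcoh hreg hYV hJY hord π hπ
      (fun hint hnoeth hX' hqe' hX3' hle' hcodim' x' _ _ _ _ W hxW _ hcl hbad hord' hdim hτ hG => ?_) (fun η' hη'η hnear => ?_)
    · haveI := hint; haveI := hnoeth
      exact hpt hX' hqe' hX3' _ hm hle' hcodim' W x' hxW hcl hbad hord' hdim hτ hG
    · exfalso
      have hirrY : IsIrreducible (Y : Set X) := by rw [hYη]; exact isIrreducible_singleton.closure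
      have hclη' : closure {π η'} = (Y : Set X) := by rw [hη'η, hYη]
      have hcohπη' : Order.coheight (π η') = 2 := by rw [hη'η]; exact hcoh
      haveI : IsLocallyNoetherian X' := hπ.isLocallyNoetherian
      obtain ⟨-, hnearΓ, hontoΓ⟩ := hπ.isRegular_gammaPrime_of_isNear_curve hX hirrY hreg hm hord hle hclη' hcohπη' hnear
      obtain ⟨-, -, -, -, -, -, -, -, -, -, -, hlt, -⟩ :=
        curveData_of_isNear_generic hm hX hqe hX3 J hle hcodim V Y η hYη hcoh hreg hYV hJY hord π hπ hη'η hnear hnearΓ hontoΓ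
      have h := hlt.trans_le hlen
      simp at h
  | succ N ih =>
    intro X _ _ hX hqe hX3 J hle hcodim V Y η hYη hcoh hreg hYV hJY hord hlen
    obtain ⟨X', π, hπ⟩ := exists_isBlowup X (vanishingIdeal Y)
    refine orderReducible_comap_of_curve_step_local hm hX hqe hX3 J hle hcodim V Y η hYη hcoh hreg hYV hJY hord π hπ
      (fun hint hnoeth hX' hqe' hX3' hle' hcodim' x' _ _ _ _ W hxW _ hcl hbad hord' hdim hτ hG => ?_) (fun η' hη'η hnear => ?_)
    · haveI := hint; haveI := hnoeth
      exact hpt hX' hqe' hX3' _ hm hle' hcodim' W x' hxW hcl hbad hord' hdim hτ hG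
    · have hirrY : IsIrreducible (Y : Set X) := by rw [hYη]; exact isIrreducible_singleton.closure
      have hclη' : closure {π η'} = (Y : Set X) := by rw [hη'η, hYη]
      have hcohπη' : Order.coheight (π η') = 2 := by rw [hη'η]; exact hcoh
      haveI : IsLocallyNoetherian X' := hπ.isLocallyNoetherian
      obtain ⟨hregΓ, hnearΓ, hontoΓ⟩ := hπ.isRegular_gammaPrime_of_isNear_curve hX hirrY hreg hm hord hle hclη' hcohπη' hnear
      obtain ⟨hint', hnoeth', hX', hqe', hX3', hle', hcodim', hcohη', hΓV, hbadΓ, hordΓ, hlt, -⟩ :=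
        curveData_of_isNear_generic hm hX hqe hX3 J hle hcodim V Y η hYη hcoh hreg hYV hJY hord π hπ hη'η hnear hnearΓ hontoΓ
      haveI := hint'; haveI := hnoeth'
      exact ih hX' hqe' hX3' _ hle' hcodim' (π ⁻¹ᵁ V) ⟨closure {η'}, isClosed_closure⟩ η' rfl hcohη' hregΓ hΓV hbadΓ hordΓ
        (enat_le_of_lt_of_le_add_one hlt (by exact_mod_cast hlen))

/-- **The regular-curve slice from the RICH point-slice oracle** (statement = `orderReducible_comap_of_curve_of_pointSlice'` with `hpt` asked only on integral
Noetherian quasi-excellent `X` of dimension `≤ 3`). [cite: CossartPiltant2008, Prop. 4.4 (proof, p. 10), Lemma 4.3 (2) (4)] -/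
theorem orderReducible_comap_of_curve_of_pointSliceRich {X : Scheme.{u}} [IsIntegral X] [IsNoetherian X]
    (hX : Scheme.IsRegular X) (hqe : Scheme.IsQuasiExcellent X) (hX3 : topologicalKrullDim X ≤ 3)
    (J : X.IdealSheafData) {m : ℕ} (hm : 1 ≤ m) (hle : ∀ z, idealOrder J z ≤ m)
    (hcodim : ∀ z ∈ J.support, 1 < Order.coheight z) (V : X.Opens) (Y : Closeds X)
    (hreg : Scheme.IsRegular (vanishingIdeal Y).subscheme) (hirr : IsIrreducible (Y : Set X))
    (hYV : (Y : Set X) ⊆ (V : Set X))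
    (hJY : ∀ z : X, (m : ℕ∞) ≤ idealOrder J z → z ∈ (Y : Set X) ∨ z ∉ (V : Set X))
    (hord : ∀ y ∈ (Y : Set X), idealOrder J y = m)
    (hcurve : ∀ y ∈ (Y : Set X), haveI := hX y; ∃ c : Fin 2 → X.presheaf.stalk y, IsRsopPart c ∧
      Ideal.span (Set.range c) = stalkIdeal (vanishingIdeal Y) y)
    (hpt : ∀ ⦃X : Scheme.{u}⦄ [IsIntegral X] [IsNoetherian X] (hX : Scheme.IsRegular X) (_hqe : Scheme.IsQuasiExcellent X)
      (_hX3 : topologicalKrullDim X ≤ 3) (J : X.IdealSheafData) ⦃m : ℕ⦄ (_hm : 1 ≤ m)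
      (_hle : ∀ z, idealOrder J z ≤ m) (_hcodim : ∀ z ∈ J.support, 1 < Order.coheight z) (V : X.Opens) (x : X) (_hxV : x ∈ V)
      (_hcl : IsClosed ({x} : Set X)) (_hbad : ∀ z : X, (m : ℕ∞) ≤ idealOrder J z → z = x ∨ z ∉ (V : Set X))
      (_hord : idealOrder J x = m) (_hdim : (maximalIdeal (X.presheaf.stalk x)).spanFinrank = 3)
      (_hτ : haveI := hX x; stalkTau J x m = 1) (_hG : IsGRing (X.presheaf.stalk x)),
      CampaignW46.OrderReducible (J.comap V.ι) m) :
    CampaignW46.OrderReducible (J.comap V.ι) m := by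
  let η : X := hirr.genericPoint
  have hYη : (Y : Set X) = closure {η} := (hirr.closure_genericPoint Y.isClosed).symm
  have hηY : η ∈ (Y : Set X) := by rw [hYη]; exact subset_closure rfl
  haveI := hX η
  have hcoh : Order.coheight η = 2 := by
    obtain ⟨c, hcr, hcY⟩ := hcurve η hηY
    rw [stalkIdeal_vanishingIdeal_eq_maximalIdeal_of_closure_eq hYη] at hcY
    have hq := hcr.ringKrullDim_quotient_add
    rw [hcY] at hq
    letI := Ideal.Quotient.field (maximalIdeal (X.presheaf.stalk η))
    rw [ringKrullDim_eq_zero_of_field, zero_add, ringKrullDim_stalk_eq_coheight] at hq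
    have h2 : ((Order.coheight η : ℕ∞) : WithBot ℕ∞) = ((2 : ℕ∞) : WithBot ℕ∞) := hq.symm.trans (by rfl)
    exact WithBot.coe_injective h2
  have hmax : η ∈ maxPoints (J.support : Set X) :=
    mem_maxPoints_support_of_coheight_eq_two hcodim
      (by rw [SetLike.mem_coe, ← one_le_idealOrder_iff, hord η hηY]; exact_mod_cast hm) hcoh
  obtain ⟨N, hN⟩ := ENat.ne_top_iff_exists.mp (length_quotient_stalkIdeal_ne_top_of_mem_maxPoints hmax)
  exact orderReducible_comap_of_curve_aux_rich hpt hm N hX hqe hX3 J hle hcodim V Y η hYη hcoh hreg hYV hJY hord hN.symm.le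

/-- **The patching skeleton's `stub_curve` from the RICH point-slice oracle ALONE** (binders of `stub_curve`, skeleton v3.1, VERBATIM with the riders `[IsNoetherian X]`,
`hX3`, then the one oracle `hpt` in the shape of res-inputs-p-8a's `orderReducible_comap_of_isolated_tau_one_of_descent`). [cite: CossartPiltant2008, Prop. 4.4 (proof,
p. 10), Lemma 4.3 (2) (4), Lemma 4.5 (1)] -/
theorem stub_curve_of_pointSliceRich {X : Scheme.{u}} [IsIntegral X] [IsNoetherian X] (hX : Scheme.IsRegular X)
    (hqe : Scheme.IsQuasiExcellent X) (hX3 : topologicalKrullDim X ≤ 3) (J : X.IdealSheafData) {m : ℕ} (hm : 1 ≤ m)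
    (hle : ∀ z, idealOrder J z ≤ m)
    (hcodim : ∀ z ∈ J.support, 1 < Order.coheight z) (V : X.Opens) (Y : Closeds X)
    (hreg : Scheme.IsRegular (vanishingIdeal Y).subscheme) (hirr : IsIrreducible (Y : Set X)) (hYV : (Y : Set X) ⊆ (V : Set X))
    (hJY : ∀ z : X, (m : ℕ∞) ≤ idealOrder J z → z ∈ (Y : Set X) ∨ z ∉ (V : Set X))
    (hord : ∀ y ∈ (Y : Set X), idealOrder J y = m)
    (hcurve : ∀ y ∈ (Y : Set X), haveI := hX y; ∃ c : Fin 2 → X.presheaf.stalk y, IsRsopPart c ∧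
      Ideal.span (Set.range c) = stalkIdeal (vanishingIdeal Y) y)
    (_hτ1 : ¬ ∀ y ∈ (Y : Set X), haveI := hX y; 2 ≤ stalkTau J y m)
    (hpt : ∀ ⦃X : Scheme.{u}⦄ [IsIntegral X] [IsNoetherian X] (hX : Scheme.IsRegular X) (_hqe : Scheme.IsQuasiExcellent X)
      (_hX3 : topologicalKrullDim X ≤ 3) (J : X.IdealSheafData) ⦃m : ℕ⦄ (_hm : 1 ≤ m)
      (_hle : ∀ z, idealOrder J z ≤ m) (_hcodim : ∀ z ∈ J.support, 1 < Order.coheight z) (V : X.Opens) (x : X) (_hxV : x ∈ V)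
      (_hcl : IsClosed ({x} : Set X)) (_hbad : ∀ z : X, (m : ℕ∞) ≤ idealOrder J z → z = x ∨ z ∉ (V : Set X))
      (_hord : idealOrder J x = m) (_hdim : (maximalIdeal (X.presheaf.stalk x)).spanFinrank = 3)
      (_hτ : haveI := hX x; stalkTau J x m = 1) (_hG : IsGRing (X.presheaf.stalk x)),
      CampaignW46.OrderReducible (J.comap V.ι) m) :
    CampaignW46.OrderReducible (J.comap V.ι) m :=
  orderReducible_comap_of_curve_of_pointSliceRich hX hqe hX3 J hm hle hcodim V Y hreg hirr hYV hJY hord hcurve hpt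

end CP2008Prop44

end Summit.ResolutionOfSingularities.ResolutionOfSingularities.Theorems

end
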